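import Mathlib
import Summits.MatrixMultiplication.MatrixMultiplication.Theorems.SnSubsetDichotomyHyperoctahedralThresholdRootTypicalSum
import Summits.MatrixMultiplication.MatrixMultiplication.Theorems.SnSubsetDichotomyHyperoctahedralThresholdRootSelfCleanSum

/-!
# A typical root exists (crux `HyperoctahedralThreshold`, line `stub_poorRigidCore`, STUB-PLAN §2 "T1+T2+Markov")

Conventions of the line: three fixed-point-free involutions `μ d` of `Fin n` act on the right,
`y · β := β.foldl (fun w d => μ d w) y`; reduced words are `List.IsChain (· ≠ ·)`; the reduced words of length `a`
form `TwinSupplyCS.RW a` (`|RW a| = 3 · 2^(a-1)` for `a ≥ 1`).  A ROOT is an ordered pair `(v, x)` of points;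
seen from the root, a word `β` has the two trajectories `t ↦ v · β_[t]`, `t ↦ x · β_[t]` (`β_[t] = β.take t`,
`t ≤ a`) and the rungs `r_t := (v · β_[t], x · β_[t])`.  The finset `Φ(v, x)` of the registered atom `stub_rootAtom`
consists of the reduced words of length `a` that are `F`-TYPICAL (both trajectories avoid `F`) and SELF-CLEAN (any two
rungs are equal, swapped or disjoint) from `(v, x)`.

* `TypicalRoot.card_le_cover` — at one root, `RW a ⊆ Φ ∪ NotF ∪ NotSelf`, hence
  `|RW a| ≤ |Φ| + |NotF| + |NotSelf|` (abstract in the two clauses).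
* `TypicalRoot.exists_root` — Markov / averaging: if `4 |Φ(v, x)| < 2 |RW a|` at every root with `v ≠ x`, then
  `2 |RW a| + 1 ≤ 4 (|NotF| + |NotSelf|)` there; summing over the `n (n - 1)` off-diagonal roots and bounding by the
  full double sums gives `n (n - 1) (2 |RW a| + 1) ≤ 4 (A + B)`, contradicting the arithmetic hypothesis.
* `TypicalRoot.arith` — the arithmetic: with `A = 2 (a+1) |F| n (3 · 2^a)` (T1, `stub_rootTypicalSum`) and
  `B = (a+1)² n (3 · 2^a) (Φ₀+1)` (T2, `stub_rootSelfCleanSum`), `3 · 2^a = 2 |RW a|`, the hypothesis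
  `8 (a+1) (2 |F| + (a+1) (Φ₀+1)) ≤ n` and `n ≥ 2` give `4 (A + B) < n (n - 1) (3 · 2^a + 1)`.
* `stub_typicalRoot` — the registered form: some root `v ≠ x` has `3 · 2^a ≤ 4 |Φ(v, x)|`.

Pure finite combinatorics on top of the landed Markov numerators T1 and T2; no definitions.
-/

-- the tree's namespace `Summit.MatrixMultiplication.MatrixMultiplication.…` repeats a component by design
set_option linter.dupNamespace false

namespace Summit.MatrixMultiplication.MatrixMultiplication.Theorems.HyperoctahedralThreshold

namespace TypicalRoot

open Finset

/-- Cover at one root, abstract in the clauses: every `β ∈ W` (with `β ∈ U`, `C β`) satisfies both clauses `P`, `Q`,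
or fails `P`, or fails `Q`; hence `|W| ≤ |{C ∧ P ∧ Q}| + |{C ∧ ¬P}| + |{C ∧ ¬Q}|`. -/
theorem card_le_cover {α : Type*} [DecidableEq α] (U W : Finset α) (C P Q : α → Prop) [DecidablePred C]
    [DecidablePred P] [DecidablePred Q] (hW : ∀ β ∈ W, β ∈ U ∧ C β) :
    W.card ≤ (U.filter fun β => C β ∧ P β ∧ Q β).card + (U.filter fun β => C β ∧ ¬ P β).card +
      (U.filter fun β => C β ∧ ¬ Q β).card :=
  calc W.card ≤ ((U.filter fun β => C β ∧ P β ∧ Q β) ∪ (U.filter fun β => C β ∧ ¬ P β) ∪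
        (U.filter fun β => C β ∧ ¬ Q β)).card := by
        refine Finset.card_le_card fun β hβ => ?_
        obtain ⟨hU, hC⟩ := hW β hβ
        rw [Finset.mem_union, Finset.mem_union, Finset.mem_filter, Finset.mem_filter, Finset.mem_filter]
        by_cases hP : P β
        · by_cases hQ : Q β
          · exact Or.inl (Or.inl ⟨hU, hC, hP, hQ⟩)
          · exact Or.inr ⟨hU, hC, hQ⟩
        · exact Or.inl (Or.inr ⟨hU, hC, hP⟩)
    _ ≤ (U.filter fun β => C β ∧ P β ∧ Q β).card + (U.filter fun β => C β ∧ ¬ P β).card +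
        (U.filter fun β => C β ∧ ¬ Q β).card :=
        (Finset.card_union_le _ _).trans (Nat.add_le_add_right (Finset.card_union_le _ _) _)

/-- **Markov / averaging step**, abstract in the clauses.  `W` is the set of words (all in the universe `U` and
satisfying `C`), `P v x`, `Q v x` are the two clauses at the root `(v, x)`, and `A`, `B` bound the double sums of the
clause failures.  If `4 (A + B) < n (n - 1) (2 |W| + 1)` then some root `v ≠ x` has `2 |W| ≤ 4 |{C ∧ P v x ∧ Q v x}|`:
otherwise every off-diagonal root has `2 |W| + 1 ≤ 4 (|{C ∧ ¬ P v x}| + |{C ∧ ¬ Q v x}|)` by `card_le_cover`, and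
summing over the `n (n - 1)` off-diagonal roots (then over all roots) contradicts the hypothesis. -/
theorem exists_root {n A B : ℕ} (U W : Finset (List (Fin 3))) (C : List (Fin 3) → Prop)
    (P Q : Fin n → Fin n → List (Fin 3) → Prop) [DecidablePred C] [∀ v x, DecidablePred (P v x)]
    [∀ v x, DecidablePred (Q v x)] (hW : ∀ β ∈ W, β ∈ U ∧ C β)
    (hA : ∑ v, ∑ x, (U.filter fun β => C β ∧ ¬ P v x β).card ≤ A)
    (hB : ∑ v, ∑ x, (U.filter fun β => C β ∧ ¬ Q v x β).card ≤ B)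
    (harith : 4 * (A + B) < n * ((n - 1) * (2 * W.card + 1))) :
    ∃ v x : Fin n, v ≠ x ∧ 2 * W.card ≤ 4 * (U.filter fun β => C β ∧ P v x β ∧ Q v x β).card := by
  by_contra h
  push Not at h
  -- per off-diagonal root
  have hroot : ∀ v x, v ≠ x → 2 * W.card + 1 ≤
      4 * ((U.filter fun β => C β ∧ ¬ P v x β).card + (U.filter fun β => C β ∧ ¬ Q v x β).card) := by
    intro v x hvx
    have h1 := card_le_cover U W C (P v x) (Q v x) hW
    have h2 := h v x hvx
    omega
  -- per row `v`: sum over `x ≠ v`, then enlarge to all `x`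
  have hrow : ∀ v : Fin n, (n - 1) * (2 * W.card + 1) ≤
      ∑ x, 4 * ((U.filter fun β => C β ∧ ¬ P v x β).card + (U.filter fun β => C β ∧ ¬ Q v x β).card) := by
    intro v
    calc (n - 1) * (2 * W.card + 1)
        = ∑ _x ∈ (Finset.univ : Finset (Fin n)).erase v, (2 * W.card + 1) := by
          rw [Finset.sum_const, smul_eq_mul, Finset.card_erase_of_mem (Finset.mem_univ v), Finset.card_univ,
            Fintype.card_fin]
      _ ≤ ∑ x ∈ (Finset.univ : Finset (Fin n)).erase v,
            4 * ((U.filter fun β => C β ∧ ¬ P v x β).card + (U.filter fun β => C β ∧ ¬ Q v x β).card) :=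
          Finset.sum_le_sum fun x hx => hroot v x (Finset.ne_of_mem_erase hx).symm
      _ ≤ ∑ x, 4 * ((U.filter fun β => C β ∧ ¬ P v x β).card + (U.filter fun β => C β ∧ ¬ Q v x β).card) :=
          Finset.sum_le_sum_of_subset (Finset.erase_subset _ _)
  -- total
  have htot : n * ((n - 1) * (2 * W.card + 1)) ≤ 4 * (A + B) :=
    calc n * ((n - 1) * (2 * W.card + 1)) = ∑ _v : Fin n, (n - 1) * (2 * W.card + 1) := by
          rw [Finset.sum_const, smul_eq_mul, Finset.card_univ, Fintype.card_fin]
      _ ≤ ∑ v, ∑ x, 4 * ((U.filter fun β => C β ∧ ¬ P v x β).card + (U.filter fun β => C β ∧ ¬ Q v x β).card) :=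
          Finset.sum_le_sum fun v _ => hrow v
      _ = 4 * (∑ v, ∑ x, (U.filter fun β => C β ∧ ¬ P v x β).card +
            ∑ v, ∑ x, (U.filter fun β => C β ∧ ¬ Q v x β).card) := by
          rw [← Finset.sum_add_distrib, Finset.mul_sum]
          refine Finset.sum_congr rfl fun v _ => ?_
          rw [← Finset.sum_add_distrib, Finset.mul_sum]
      _ ≤ 4 * (A + B) := Nat.mul_le_mul_left 4 (Nat.add_le_add hA hB)
  exact absurd harith (not_lt.2 htot)

/-- **The arithmetic.**  With `S = 3 · 2^a`, `K = a + 1`, `f = |F|`, `q = Φ₀ + 1`: if `8 K (2 f + K q) ≤ n` and `n ≥ 2`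
then `4 (2 K f n S + K² n S q) < n (n - 1) (S + 1)` (twice the left side is `n S · 8 K (2 f + K q) ≤ n S n`, and
`n² S < 2 n (n - 1) (S + 1)` for `n ≥ 2`). -/
theorem arith {n S K f q : ℕ} (hn : 2 ≤ n) (h : 8 * K * (2 * f + K * q) ≤ n) :
    4 * (2 * K * f * n * S + K ^ 2 * n * S * q) < n * ((n - 1) * (S + 1)) := by
  obtain ⟨m, rfl⟩ : ∃ m, n = m + 2 := ⟨n - 2, by omega⟩
  have e : m + 2 - 1 = m + 1 := by omega
  rw [e]
  have h1 : 2 * (4 * (2 * K * f * (m + 2) * S + K ^ 2 * (m + 2) * S * q)) ≤ (m + 2) * S * (m + 2) :=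
    calc 2 * (4 * (2 * K * f * (m + 2) * S + K ^ 2 * (m + 2) * S * q))
        = (m + 2) * S * (8 * K * (2 * f + K * q)) := by ring
      _ ≤ (m + 2) * S * (m + 2) := Nat.mul_le_mul_left _ h
  have h2 : (m + 2) * S * (m + 2) < 2 * ((m + 2) * ((m + 1) * (S + 1))) := by
    have e2 : 2 * ((m + 2) * ((m + 1) * (S + 1))) =
        (m + 2) * S * (m + 2) + ((m + 2) * S * m + 2 * (m + 2) * (m + 1)) := by ring
    rw [e2]
    have h3 : 0 < 2 * (m + 2) * (m + 1) := Nat.mul_pos (by omega) (by omega)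
    omega
  omega

end TypicalRoot

/-- **`stub_typicalRoot`** (registered sub-goal of stmt-MatrixMultiplication-10883, STUB-PLAN §2 "T1+T2+Markov" of the
line `stub_poorRigidCore`): for fixed-point-free involutions `μ d`, a depth `a ≥ 1`, a fixed-point bound `Φ₀` for the
nonempty reduced words of length `≤ a`, and a forbidden set `F` with `8 (a+1) (2 |F| + (a+1) (Φ₀+1)) ≤ n` (`n ≥ 2`),
some root `v ≠ x` is typical: at least `3 · 2^a / 4 = |RW a| / 2` of the `3 · 2^(a-1)` reduced words of length `a`
are `F`-typical and self-clean from `(v, x)`.  Proof: `TypicalRoot.exists_root` fed with the Markov numerators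
`stub_rootTypicalSum` (T1) and `stub_rootSelfCleanSum` (T2) and the arithmetic `TypicalRoot.arith`. -/
theorem stub_typicalRoot : ∀ (n a Φ₀ : ℕ) (μ : Fin 3 → Equiv.Perm (Fin n)) (F : Finset (Fin n)), (∀ b, μ b * μ b = 1) → (∀ b w, μ b w ≠ w) → 1 ≤ a → 2 ≤ n → (∀ w : List (Fin 3), w ≠ [] → List.IsChain (· ≠ ·) w → w.length ≤ a → ((Finset.univ : Finset (Fin n)).filter (fun y => w.foldl (fun v b => μ b v) y = y)).card ≤ Φ₀) → 8 * (a + 1) * (2 * F.card + (a + 1) * (Φ₀ + 1)) ≤ n → ∃ v x : Fin n, v ≠ x ∧ 3 * 2 ^ a ≤ 4 * (((Finset.univ : Finset (List.Vector (Fin 3) a)).image List.Vector.toList).filter (fun β => List.IsChain (· ≠ ·) β ∧ (∀ t ≤ a, (β.take t).foldl (fun w d => μ d w) v ∉ F ∧ (β.take t).foldl (fun w d => μ d w) x ∉ F) ∧ (∀ s ≤ a, ∀ t ≤ a, ((((β.take s).foldl (fun w d => μ d w) v) = ((β.take t).foldl (fun w d => μ d w) v) ∧ ((β.take s).foldl (fun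 w d => μ d w) x) = ((β.take t).foldl (fun w d => μ d w) x)) ∨ (((β.take s).foldl (fun w d => μ d w) v) = ((β.take t).foldl (fun w d => μ d w) x) ∧ ((β.take s).foldl (fun w d => μ d w) x) = ((β.take t).foldl (fun w d => μ d w) v)) ∨ (((β.take s).foldl (fun w d => μ d w) v) ≠ ((β.take t).foldl (fun w d => μ d w) v) ∧ ((β.take s).foldl (fun w d => μ d w) v) ≠ ((β.take t).foldl (fun w d => μ d w) x) ∧ ((β.take s).foldl (fun w d => μ d w) x) ≠ ((β.take t).foldl (fun w d => μ d w) v) ∧ ((β.take s).foldl (fun w d => μ d w) x) ≠ ((β.take t).foldl (fun w d => μ d w) x)))))).card := by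
  intro n a Φ₀ μ F hμ hfpf ha hn hΦ₀ hbig
  have hW : (TwinSupplyCS.RW a).card = 3 * 2 ^ (a - 1) := TwinSupplyCS.card_RW ha
  have h2T : 2 * (3 * 2 ^ (a - 1)) = 3 * 2 ^ a := by
    have e : 2 ^ a = 2 ^ (a - 1) * 2 := by rw [← pow_succ, Nat.sub_add_cancel ha]
    rw [e]
    ring
  have hWmem : ∀ β ∈ TwinSupplyCS.RW a,
      β ∈ (Finset.univ : Finset (List.Vector (Fin 3) a)).image List.Vector.toList ∧ List.IsChain (· ≠ ·) β := by
    intro β hβ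
    obtain ⟨hl, hc⟩ := TwinSupplyCS.mem_RW.1 hβ
    exact ⟨Finset.mem_image.2 ⟨⟨β, hl⟩, Finset.mem_univ _, rfl⟩, hc⟩
  have harith : 4 * (2 * (a + 1) * F.card * n * (3 * 2 ^ a) + (a + 1) ^ 2 * n * (3 * 2 ^ a) * (Φ₀ + 1)) <
      n * ((n - 1) * (2 * (TwinSupplyCS.RW a).card + 1)) := by
    rw [hW, h2T]
    exact TypicalRoot.arith hn hbig
  obtain ⟨v, x, hvx, h⟩ := TypicalRoot.exists_root _ _ _ _ _ hWmem (stub_rootTypicalSum n a μ F hμ)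
    (stub_rootSelfCleanSum n a Φ₀ μ hμ hfpf ha hΦ₀) harith
  refine ⟨v, x, hvx, ?_⟩
  rw [← h2T, ← hW]
  exact h

end Summit.MatrixMultiplication.MatrixMultiplication.Theorems.HyperoctahedralThreshold
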